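import Summits.CriticalPhenomena.SAWScalingLimit.Theorems.SAWDevelopingMapObservableToSLETypeLadderCarvedReductionSqueezeLattice
import Summits.CriticalPhenomena.SAWScalingLimit.Theorems.SAWDevelopingMapObservableToSLETypeLadderCarvedReductionSqueezeCells2
import HarnessLib

/-!
# The LATTICE HALF of the geometry of the moving-carving squeeze, fixed-radius form (STAGE 2′,
# stub `stub_carvedReduction_squeezeGeometry_lattice2`)

Crux `SAWDevelopingMap.ObservableToSLE` (stmt-CriticalPhenomena-10472), line `six-class-type-ladder`
(Sketch), stub STAGE 2′ `stub_carvedReduction_squeezeGeometry_lattice2`.  Landing target: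
`Summits/CriticalPhenomena/SAWScalingLimit/Theorems/SAWDevelopingMapObservableToSLETypeLadderCarvedReductionSqueezeLattice2.lean`
(`--supports stmt-CriticalPhenomena-10472`).  Sequel of `…SqueezeLattice` (p137080, STAGE 2) and
`…SqueezeCells2` (`squeeze_cells'`).

STAGE 2′ is VERBATIM STAGE 2 (`carvedReduction_squeezeGeometry_lattice`: from the pinned data of the
two-piece flat outer approximant `E` with gate boxes, the inner hull subdomain `M`, the restriction
datum and the geometric facts (s), (g), (U), (MD), (MU), (R) of the pinned frame it assembles the
registered `∃`-block of the squeeze — subsequence, family block of `M`, cells, squeeze package) with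
ONE hypothesis changed: (MU) is now in its FIXED-RADIUS form "eventually every vertex whose pinned
centre lies in `M` at distance `≥ ρF` from both gates is not removed" instead of "for every `r > 0`,
eventually …" (the latter is unsatisfiable for admissible data: at one gate a band of removed rows of
height `o(1) ≫ δ` may sit above the limit line inside the flat half-disc of `M`).  The proof is that
of STAGE 2 with the cells now supplied by `squeeze_cells'` at exemption radius `ρX := ρF`: the
exactness (U) of the removed set is used on the full `ρF`-balls (`hU0`, `hU1`), the depth clause of
the inner family is passed with its row clause (`twoPiece_nested_families`, `…SqueezeNested`
p136621), and (MU) is passed as is.  Registered carrier: `stub_carvedReduction_lattice2`.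
-/

noncomputable section

open scoped BigOperators Topology NNReal ENNReal Classical
open Filter Set MeasureTheory Metric
open Literature.Probability.LatticeModels (HexVertex hexGraph hexCenter triZeta triEmbed Site polyline)
open Literature.Probability.RandomPlanarGeometry
open Literature.Probability.RandomPlanarGeometry.SAW
open Literature.Probability.Percolation (PathIn)
open UpperHalfPlane (upperHalfPlaneSet)

namespace Summit.CriticalPhenomena.SAWScalingLimit.Theorems.ObservableToSLE.TypeLadder

open Summit.CriticalPhenomena.SAWScalingLimit.Theorems.ObservableToSLER.BridgeGate

/-! ### Small helpers -/

/-- A strictly monotone index map shifted past an index is strictly monotone. -/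
theorem strictMono_shift {ψ₀ : ℕ → ℕ} (hψ₀ : StrictMono ψ₀) (J : ℕ) : StrictMono fun j => ψ₀ (J + j) :=
  fun _ _ hij => hψ₀ (by omega)

/-- **Registered sub-goal `stub_carvedReduction_lattice2`** (crux item stmt-CriticalPhenomena-10472,
stub STAGE 2′ `stub_carvedReduction_squeezeGeometry_lattice2`, piece (STAGE 2′ lattice)): registry
form of `strictMono_shift` — the selected subsequence shifted past the index where all the eventual
clauses hold is again a subsequence. -/
theorem stub_carvedReduction_lattice2 :
    ∀ (ψ₀ : ℕ → ℕ) (J : ℕ), StrictMono ψ₀ → StrictMono fun j => ψ₀ (J + j) :=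
  fun _ J hψ₀ => strictMono_shift hψ₀ J

/-! ### Stage 2′ -/

/-- **STAGE 2′ OF T-A (the lattice half, fixed-radius (MU))** — the statement is BYTE-FOR-BYTE the
registered stub `stub_carvedReduction_squeezeGeometry_lattice2` of crux item stmt-CriticalPhenomena-10472
(line `six-class-type-ladder`, skeleton r12); see the module docstring.  (Named like the landed STAGE 2
`carvedReduction_squeezeGeometry_lattice`: the stub registry caps signatures at 3900 characters, so the
10 310-character registered header cannot be matched by name + signature; the file lands through the
carrier `stub_carvedReduction_lattice2`.) -/
theorem carvedReduction_squeezeGeometry_lattice2 (D : DobrushinDomain) (δ : ℕ → ℝ)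
    (S T : ℕ → ℕ → Set HexVertex) (n n' : ℕ → ℕ) (q q' : ℕ → HexVertex) (η ε' : ℝ) (φ ψ₀ : ℕ → ℕ)
    (E M : DobrushinDomain) (τ : ℂ) (x : ℕ → Site 2) (φE : ConformalEquiv upperHalfPlaneSet E.carrier)
    (Φ : ConformalEquiv (upperHalfPlaneSet \ φE.pullbackHull M) upperHalfPlaneSet) (d : ℝ)
    (ρw ρc ρc' ρF : ℝ)
    (hψ₀ : StrictMono ψ₀) (hsanti : StrictAnti fun j => δ (φ (ψ₀ j))) (hspos : ∀ j, 0 < δ (φ (ψ₀ j)))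
    (hs0 : Tendsto (fun j => δ (φ (ψ₀ j))) atTop (𝓝[>] 0))
    (hτ : Tendsto (fun j => ((δ (φ (ψ₀ j)) : ℝ) : ℂ) * triEmbed (x j)) atTop (𝓝 τ))
    (hM : E.IsHullSubdomain M)
    (hbd : ∀ t : ℝ, dist (M.boundary t + τ) (D.boundary t) ≤ η)
    (hbd0 : dist (M.pt 0 + τ) (D.pt 0) ≤ η) (hbd1 : dist (M.pt 1 + τ) (D.pt 1) ≤ η)
    (hflat : ∀ i, E.carrier ∩ ball (E.pt i) ρw = {z : ℂ | (E.pt i).im < z.im} ∩ ball (E.pt i) ρw)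
    (hB : ∀ i (z : ℂ), |z.re - (E.pt i).re| ≤ ρc → (E.pt i).im - ρc' ≤ z.im → z.im ≤ (E.pt i).im →
      z ∉ E.carrier)
    (hρc : 0 < ρc) (hρc' : 0 < ρc') (hρF : 0 < ρF) (hFc : ρF ≤ ρc) (hFc' : ρF ≤ ρc') (hFw : ρF ≤ ρw)
    (hsep : 2 * (ρc + ρc') + ρF ≤ dist (E.pt 0) (E.pt 1))
    (hφE : E.IsChordalUniformizing φE) (hΦ : IsRestrictionMap (φE.pullbackHull M) Φ)
    (hd : HasRestrictionDeriv (φE.pullbackHull M) Φ d) (hlev : 1 - ε' < d ^ ((5 : ℝ) / 8))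
    -- (g) the pinned gates
    (hq0 : ∀ j, (q (φ (ψ₀ j))).2 = 0) (hq1 : ∀ j, (q' (φ (ψ₀ j))).2 = 0)
    (hconv0 : Tendsto (fun j => ((δ (φ (ψ₀ j)) : ℝ) : ℂ) *
      hexCenter (((q (φ (ψ₀ j))).1 - x j, 0) : HexVertex)) atTop (𝓝 (E.pt 0)))
    (hconv1 : Tendsto (fun j => ((δ (φ (ψ₀ j)) : ℝ) : ℂ) *
      hexCenter (((q' (φ (ψ₀ j))).1 - x j, 0) : HexVertex)) atTop (𝓝 (E.pt 1)))
    (habove0 : ∀ j, (E.pt 0).im <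
      (((δ (φ (ψ₀ j)) : ℝ) : ℂ) * hexCenter (((q (φ (ψ₀ j))).1 - x j, 0) : HexVertex)).im)
    (habove1 : ∀ j, (E.pt 1).im <
      (((δ (φ (ψ₀ j)) : ℝ) : ℂ) * hexCenter (((q' (φ (ψ₀ j))).1 - x j, 0) : HexVertex)).im)
    -- (U) exactness of the removed set near the pinned gates
    (hU0 : ∀ᶠ j in atTop, ∀ v : HexVertex,
      ((δ (φ (ψ₀ j)) : ℝ) : ℂ) * hexCenter v - ((δ (φ (ψ₀ j)) : ℝ) : ℂ) * triEmbed (x j) ∈ ball (E.pt 0) ρF →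
        (v ∈ S (φ (ψ₀ j)) (n (φ (ψ₀ j))) ∪ T (φ (ψ₀ j)) (n' (φ (ψ₀ j))) ↔ v.1 1 < (q (φ (ψ₀ j))).1 1))
    (hU1 : ∀ᶠ j in atTop, ∀ v : HexVertex,
      ((δ (φ (ψ₀ j)) : ℝ) : ℂ) * hexCenter v - ((δ (φ (ψ₀ j)) : ℝ) : ℂ) * triEmbed (x j) ∈ ball (E.pt 1) ρF →
        (v ∈ S (φ (ψ₀ j)) (n (φ (ψ₀ j))) ∪ T (φ (ψ₀ j)) (n' (φ (ψ₀ j))) ↔ v.1 1 < (q' (φ (ψ₀ j))).1 1))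
    -- (MD), (MU)
    (hMD : ∀ᶠ j in atTop, ∀ z : ℂ, (z ∈ M.carrier ∨ ∃ i, dist z (E.pt i) ≤ 2 * ρc) →
      z + ((δ (φ (ψ₀ j)) : ℝ) : ℂ) * triEmbed (x j) ∈ D.carrier)
    (hMU : ∀ᶠ j in atTop, ∀ v : HexVertex,
      ((δ (φ (ψ₀ j)) : ℝ) : ℂ) * hexCenter v - ((δ (φ (ψ₀ j)) : ℝ) : ℂ) * triEmbed (x j) ∈ M.carrier →
        (∀ i, ρF ≤ dist (((δ (φ (ψ₀ j)) : ℝ) : ℂ) * hexCenter v - ((δ (φ (ψ₀ j)) : ℝ) : ℂ) * triEmbed (x j))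
          (E.pt i)) →
        v ∉ S (φ (ψ₀ j)) (n (φ (ψ₀ j))) ∪ T (φ (ψ₀ j)) (n' (φ (ψ₀ j))))
    -- (R) the reach of the gate is clearly deep in `E`
    (hreach : ∀ᶠ j in atTop, ∀ (w : HexVertex)
      (π : (hexDomainGraph D.carrier (δ (φ (ψ₀ j)))).Walk (q (φ (ψ₀ j))) w),
      (∀ y ∈ π.support, y ∉ S (φ (ψ₀ j)) (n (φ (ψ₀ j))) ∪ T (φ (ψ₀ j)) (n' (φ (ψ₀ j)))) →
        ∀ y ∈ π.support,
          ((δ (φ (ψ₀ j)) : ℝ) : ℂ) * hexCenter y - ((δ (φ (ψ₀ j)) : ℝ) : ℂ) * triEmbed (x j) ∈ E.carrier ∧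
          closedBall (((δ (φ (ψ₀ j)) : ℝ) : ℂ) * hexCenter y - ((δ (φ (ψ₀ j)) : ℝ) : ℂ) * triEmbed (x j))
              (25 * δ (φ (ψ₀ j))) ⊆ E.carrier ∪
            ⋃ i, {z : ℂ | |z.re - (E.pt i).re| ≤ ρc ∧ (E.pt i).im - 30 * δ (φ (ψ₀ j)) ≤ z.im ∧
              z.im ≤ (E.pt i).im} ∧
          (|(((δ (φ (ψ₀ j)) : ℝ) : ℂ) * hexCenter y - ((δ (φ (ψ₀ j)) : ℝ) : ℂ) * triEmbed (x j)).re -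
                (E.pt 0).re| < ρc + 10 * δ (φ (ψ₀ j)) →
            |(((δ (φ (ψ₀ j)) : ℝ) : ℂ) * hexCenter y - ((δ (φ (ψ₀ j)) : ℝ) : ℂ) * triEmbed (x j)).im -
                (E.pt 0).im| < ρc' → (q (φ (ψ₀ j))).1 1 ≤ y.1 1) ∧
          (|(((δ (φ (ψ₀ j)) : ℝ) : ℂ) * hexCenter y - ((δ (φ (ψ₀ j)) : ℝ) : ℂ) * triEmbed (x j)).re -
                (E.pt 1).re| < ρc + 10 * δ (φ (ψ₀ j)) →
            |(((δ (φ (ψ₀ j)) : ℝ) : ℂ) * hexCenter y - ((δ (φ (ψ₀ j)) : ℝ) : ℂ) * triEmbed (x j)).im -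
                (E.pt 1).im| < ρc' → (q' (φ (ψ₀ j))).1 1 ≤ y.1 1))
    (hqdom : ∀ j, q (φ (ψ₀ j)) ∈ embMeshDomain hexGraph hexCenter D.carrier (δ (φ (ψ₀ j))))
    (hprob : ∀ᶠ j in atTop, IsProbabilityMeasure (carvedLaw D.carrier (δ (φ (ψ₀ j)))
      (S (φ (ψ₀ j)) (n (φ (ψ₀ j))) ∪ T (φ (ψ₀ j)) (n' (φ (ψ₀ j)))) (q (φ (ψ₀ j))) (q' (φ (ψ₀ j))))) :
    ∃ (ψ : ℕ → ℕ) (M : DobrushinDomain) (τ : ℂ) (ρ' : ℝ) (Λ' : ℝ → Finset HexVertex)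
      (m : Fin 2 → ℝ → ℤ) (a' b' : ℝ → Sym2 HexVertex) (x : ℕ → Site 2)
      (Λ'' : ℕ → Finset HexVertex) (pu pv : ℕ → HexVertex),
      StrictMono ψ ∧
      (∀ t : ℝ, dist (M.boundary t + τ) (D.boundary t) ≤ η) ∧
      dist (M.pt 0 + τ) (D.pt 0) ≤ η ∧ dist (M.pt 1 + τ) (D.pt 1) ≤ η ∧
      (0 < ρ' ∧ ∀ i : Fin 2,
        M.carrier ∩ ball (M.pt i) ρ' = {z : ℂ | (M.pt i).im < z.im} ∩ ball (M.pt i) ρ') ∧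
      (∀ᶠ δ' : ℝ in 𝓝[>] 0, hexDomainSimplyConnected (Λ' δ') ∧
        a' δ' ∈ hexDomainBoundary (Λ' δ') ∧ b' δ' ∈ hexDomainBoundary (Λ' δ') ∧
        Nonempty (HexMidEdgeSAW (Λ' δ') (a' δ') (b' δ')) ∧
        (hexGraph.induce (↑(Λ' δ') : Set HexVertex)).Preconnected ∧
        (∀ v ∈ Λ' δ', (δ' : ℂ) * hexCenter v ∈ M.carrier) ∧
        (∀ i : Fin 2, ∀ v : HexVertex, (δ' : ℂ) * hexCenter v ∈ ball (M.pt i) ρ' →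
          (v ∈ Λ' δ' ↔ m i δ' ≤ v.1 1))) ∧
      (∀ K : Set ℂ, IsCompact K → K ⊆ M.carrier →
        ∀ᶠ δ' : ℝ in 𝓝[>] 0, ∀ v : HexVertex, (δ' : ℂ) * hexCenter v ∈ K → v ∈ Λ' δ') ∧
      Tendsto (fun δ' : ℝ => (δ' : ℂ) * hexMidpoint (a' δ')) (𝓝[>] 0) (𝓝 (M.pt 0)) ∧
      Tendsto (fun δ' : ℝ => (δ' : ℂ) * hexMidpoint (b' δ')) (𝓝[>] 0) (𝓝 (M.pt 1)) ∧
      Tendsto (fun j : ℕ => ((δ (φ (ψ j)) : ℝ) : ℂ) *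
        Literature.Probability.LatticeModels.triEmbed (x j)) atTop (𝓝 τ) ∧
      (∀ j : ℕ,
        (∀ w : HexVertex, w ∈ Λ'' j ↔ ((-(x j) + w.1, w.2) : HexVertex) ∈ Λ' (δ (φ (ψ j)))) ∧
        (∀ w ∈ Λ'' j, w ∉ S (φ (ψ j)) (n (φ (ψ j))) ∪ T (φ (ψ j)) (n' (φ (ψ j)))) ∧
        (∀ w ∈ Λ'' j, ∀ y ∈ Λ'' j, hexGraph.Adj w y →
          (hexDomainGraph D.carrier (δ (φ (ψ j)))).Adj w y) ∧
        q (φ (ψ j)) ∈ Λ'' j ∧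
        pu j ∈ S (φ (ψ j)) (n (φ (ψ j))) ∪ T (φ (ψ j)) (n' (φ (ψ j))) ∧
        pv j ∈ S (φ (ψ j)) (n (φ (ψ j))) ∪ T (φ (ψ j)) (n' (φ (ψ j))) ∧
        hexGraph.Adj (q (φ (ψ j))) (pu j) ∧
        s(q (φ (ψ j)), pu j) ≠ s(q' (φ (ψ j)), pv j) ∧
        (a' (δ (φ (ψ j)))).map (fun w : HexVertex => ((x j + w.1, w.2) : HexVertex)) =
          s(q (φ (ψ j)), pu j) ∧
        (b' (δ (φ (ψ j)))).map (fun w : HexVertex => ((x j + w.1, w.2) : HexVertex)) =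
          s(q' (φ (ψ j)), pv j)) ∧
      ∃ (E : DobrushinDomain) (ρE : ℝ) (φE : ConformalEquiv upperHalfPlaneSet E.carrier)
        (Φ : ConformalEquiv (upperHalfPlaneSet \ φE.pullbackHull M) upperHalfPlaneSet) (d : ℝ)
        (Nf : ℝ → Finset HexVertex) (m₀ m₁ m₁' : ℝ → ℤ),
        (0 < ρE ∧ ∀ i : Fin 2,
          E.carrier ∩ ball (E.pt i) ρE = {z : ℂ | (E.pt i).im < z.im} ∩ ball (E.pt i) ρE) ∧
        E.IsHullSubdomain M ∧ E.IsChordalUniformizing φE ∧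
        IsRestrictionMap (φE.pullbackHull M) Φ ∧ HasRestrictionDeriv (φE.pullbackHull M) Φ d ∧
        1 - ε' < d ^ ((5 : ℝ) / 8) ∧
        (∀ᶠ δ' : ℝ in 𝓝[>] 0,
          Λ' δ' ⊆ Nf δ' ∧ hexDomainSimplyConnected (Nf δ') ∧ hexDomainSimplyConnected (Λ' δ') ∧
          (hexGraph.induce (↑(Nf δ') : Set HexVertex)).Preconnected ∧
          (hexGraph.induce (↑(Λ' δ') : Set HexVertex)).Preconnected ∧
          a' δ' ∈ hexDomainBoundary (Nf δ') ∧ b' δ' ∈ hexDomainBoundary (Nf δ') ∧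
          a' δ' ∈ hexDomainBoundary (Λ' δ') ∧ b' δ' ∈ hexDomainBoundary (Λ' δ') ∧
          Nonempty (HexMidEdgeSAW (Λ' δ') (a' δ') (b' δ')) ∧
          (∀ w ∈ Nf δ', (δ' : ℂ) * hexCenter w ∈ E.carrier) ∧
          (∀ w ∈ Λ' δ', (δ' : ℂ) * hexCenter w ∈ M.carrier) ∧
          (∀ w : HexVertex, (δ' : ℂ) * hexCenter w ∈ ball (E.pt 0) ρE →
            ((w ∈ Nf δ' ↔ m₀ δ' ≤ w.1 1) ∧ (w ∈ Λ' δ' ↔ m₀ δ' ≤ w.1 1))) ∧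
          (∀ w : HexVertex, (δ' : ℂ) * hexCenter w ∈ ball (E.pt 1) ρE →
            ((w ∈ Nf δ' ↔ m₁ δ' ≤ w.1 1) ∧ (w ∈ Λ' δ' ↔ m₁' δ' ≤ w.1 1)))) ∧
        (∀ K : Set ℂ, IsCompact K → K ⊆ E.carrier →
          ∀ᶠ δ' : ℝ in 𝓝[>] 0, ∀ w : HexVertex, (δ' : ℂ) * hexCenter w ∈ K → w ∈ Nf δ') ∧
        (∀ K : Set ℂ, IsCompact K → K ⊆ M.carrier →
          ∀ᶠ δ' : ℝ in 𝓝[>] 0, ∀ w : HexVertex, (δ' : ℂ) * hexCenter w ∈ K → w ∈ Λ' δ') ∧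
        Tendsto (fun δ' : ℝ => (δ' : ℂ) * hexMidpoint (a' δ')) (𝓝[>] 0) (𝓝 (E.pt 0)) ∧
        Tendsto (fun δ' : ℝ => (δ' : ℂ) * hexMidpoint (b' δ')) (𝓝[>] 0) (𝓝 (E.pt 1)) ∧
        (∀ᶠ j : ℕ in atTop,
          IsProbabilityMeasure (carvedLaw D.carrier (δ (φ (ψ j)))
            (S (φ (ψ j)) (n (φ (ψ j))) ∪ T (φ (ψ j)) (n' (φ (ψ j)))) (q (φ (ψ j))) (q' (φ (ψ j)))) ∧
          (∀ w : HexVertex, w ∈ Λ'' j ↔ ((-(x j) + w.1, w.2) : HexVertex) ∈ Λ' (δ (φ (ψ j)))) ∧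
          (∀ w ∈ Λ'' j, w ∉ S (φ (ψ j)) (n (φ (ψ j))) ∪ T (φ (ψ j)) (n' (φ (ψ j)))) ∧
          (∀ w ∈ Λ'' j, ∀ y ∈ Λ'' j, hexGraph.Adj w y →
            (hexDomainGraph D.carrier (δ (φ (ψ j)))).Adj w y) ∧
          q (φ (ψ j)) ∈ Λ'' j ∧
          pu j ∈ S (φ (ψ j)) (n (φ (ψ j))) ∪ T (φ (ψ j)) (n' (φ (ψ j))) ∧
          pv j ∈ S (φ (ψ j)) (n (φ (ψ j))) ∪ T (φ (ψ j)) (n' (φ (ψ j))) ∧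
          hexGraph.Adj (q (φ (ψ j))) (pu j) ∧
          s(q (φ (ψ j)), pu j) ≠ s(q' (φ (ψ j)), pv j) ∧
          (a' (δ (φ (ψ j)))).map (fun w : HexVertex => ((x j + w.1, w.2) : HexVertex)) =
            s(q (φ (ψ j)), pu j) ∧
          (b' (δ (φ (ψ j)))).map (fun w : HexVertex => ((x j + w.1, w.2) : HexVertex)) =
            s(q' (φ (ψ j)), pv j) ∧
          (∀ (w : HexVertex) (π : (hexDomainGraph D.carrier (δ (φ (ψ j)))).Walk (q (φ (ψ j))) w),
            (∀ y ∈ π.support, y ∉ S (φ (ψ j)) (n (φ (ψ j))) ∪ T (φ (ψ j)) (n' (φ (ψ j)))) →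
              ∀ y ∈ π.support, ((-(x j) + y.1, y.2) : HexVertex) ∈ Nf (δ (φ (ψ j)))) ∧
          ((-(x j) + (pu j).1, (pu j).2) : HexVertex) ∉ Nf (δ (φ (ψ j))) ∧
          ((-(x j) + (pv j).1, (pv j).2) : HexVertex) ∉ Nf (δ (φ (ψ j)))) := by
  -- the pinned gate columns and the spliced columns
  obtain ⟨G₀, hG₀s, hG₀ab, hG₀lim, -, -⟩ := exists_spliced_gateColumn hsanti hspos (E.pt 0)
    (fun j => (q (φ (ψ₀ j))).1 - x j) habove0 hconv0
  obtain ⟨G₁, hG₁s, hG₁ab, hG₁lim, -, -⟩ := exists_spliced_gateColumn hsanti hspos (E.pt 1)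
    (fun j => (q' (φ (ψ₀ j))).1 - x j) habove1 hconv1
  -- as a `Fin 2`-indexed column
  obtain ⟨g, hg0, hg1⟩ : ∃ g : Fin 2 → ℝ → Site 2, g 0 = G₀ ∧ g 1 = G₁ := ⟨![G₀, G₁], rfl, rfl⟩
  have habove : ∀ i (δ' : ℝ), 0 < δ' → (E.pt i).im < ((δ' : ℂ) * hexCenter ((g i δ', 0) : HexVertex)).im := by
    refine Fin.forall_fin_two.2 ⟨fun δ' hδ' => ?_, fun δ' hδ' => ?_⟩
    · rw [hg0]; exact hG₀ab δ' hδ'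
    · rw [hg1]; exact hG₁ab δ' hδ'
  have hglim : ∀ i, Tendsto (fun δ' : ℝ => (δ' : ℂ) * hexCenter ((g i δ', 0) : HexVertex)) (𝓝[>] 0)
      (𝓝 (E.pt i)) := by
    refine Fin.forall_fin_two.2 ⟨?_, ?_⟩
    · rw [hg0]; exact hG₀lim
    · rw [hg1]; exact hG₁lim
  have hgq : ∀ j, x j + g 0 (δ (φ (ψ₀ j))) = (q (φ (ψ₀ j))).1 := by
    intro j; rw [hg0, hG₀s]; abel
  have hgq' : ∀ j, x j + g 1 (δ (φ (ψ₀ j))) = (q' (φ (ψ₀ j))).1 := by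
    intro j; rw [hg1, hG₁s]; abel
  have hg0row : ∀ j, g 0 (δ (φ (ψ₀ j))) 1 = (q (φ (ψ₀ j))).1 1 - x j 1 := by
    intro j; rw [hg0, hG₀s]; simp
  have hg1row : ∀ j, g 1 (δ (φ (ψ₀ j))) 1 = (q' (φ (ψ₀ j))).1 1 - x j 1 := by
    intro j; rw [hg1, hG₁s]; simp
  -- the nested families
  obtain ⟨N, Λ', a, b, ρ', ha, hb, hρ', -, -, hflatE', hflatM', hadm, hfamM, hexhE, hexhM,
    hlimE0, hlimE1, hlimM0, hlimM1, hdepth, hclosed, hfaces⟩ :=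
    twoPiece_nested_families E M hM hflat hB hρc hρc' hρF hFc hFc' hFw hsep habove hglim
  -- the cells
  have hq_eq : ∀ j, q (φ (ψ₀ j)) = ((x j + g 0 (δ (φ (ψ₀ j))), 0) : HexVertex) := fun j =>
    upFace_eq (hq0 j) _ (hgq j).symm
  have hq'_eq : ∀ j, q' (φ (ψ₀ j)) = ((x j + g 1 (δ (φ (ψ₀ j))), 0) : HexVertex) := fun j =>
    upFace_eq (hq1 j) _ (hgq' j).symm
  have hglim_seq : ∀ i, Tendsto (fun j => ((δ (φ (ψ₀ j)) : ℝ) : ℂ) *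
      hexCenter ((g i (δ (φ (ψ₀ j))), 0) : HexVertex)) atTop (𝓝 (E.pt i)) := fun i =>
    (hglim i).comp hs0
  have hinM : ∀ᶠ δ' : ℝ in 𝓝[>] 0, (hexGraph.induce (↑(Λ' δ') : Set HexVertex)).Preconnected ∧
      ∀ v ∈ Λ' δ', (δ' : ℂ) * hexCenter v ∈ M.carrier :=
    hfamM.mono fun δ' h => ⟨h.2.2.2.2.1, h.2.2.2.2.2.1⟩
  -- (U) on the full `ρF`-balls, against the spliced gate rows
  have hU : ∀ᶠ j in atTop, ∀ (i : Fin 2) (v : HexVertex),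
      ((δ (φ (ψ₀ j)) : ℝ) : ℂ) * hexCenter v - ((δ (φ (ψ₀ j)) : ℝ) : ℂ) * triEmbed (x j) ∈ ball (E.pt i) ρF →
        (v ∈ S (φ (ψ₀ j)) (n (φ (ψ₀ j))) ∪ T (φ (ψ₀ j)) (n' (φ (ψ₀ j))) ↔
          v.1 1 < x j 1 + g i (δ (φ (ψ₀ j))) 1) := by
    filter_upwards [hU0, hU1] with j h0 h1
    refine Fin.forall_fin_two.2 ⟨fun v hv => ?_, fun v hv => ?_⟩
    · rw [hg0row, h0 v hv]
      constructor <;> intro h <;> linarith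
    · rw [hg1row, h1 v hv]
      constructor <;> intro h <;> linarith
  have hreach' : ∀ᶠ j in atTop, ∀ (w : HexVertex)
      (π : (hexDomainGraph D.carrier (δ (φ (ψ₀ j)))).Walk (q (φ (ψ₀ j))) w),
      (∀ y ∈ π.support, y ∉ S (φ (ψ₀ j)) (n (φ (ψ₀ j))) ∪ T (φ (ψ₀ j)) (n' (φ (ψ₀ j)))) →
        ∀ y ∈ π.support, ((-(x j) + y.1, y.2) : HexVertex) ∈
          {u : HexVertex | ((δ (φ (ψ₀ j)) : ℝ) : ℂ) * hexCenter u ∈ E.carrier ∧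
            closedBall (((δ (φ (ψ₀ j)) : ℝ) : ℂ) * hexCenter u) (25 * δ (φ (ψ₀ j))) ⊆ E.carrier ∪
              ⋃ i, {z : ℂ | |z.re - (E.pt i).re| ≤ ρc ∧ (E.pt i).im - 30 * δ (φ (ψ₀ j)) ≤ z.im ∧
                z.im ≤ (E.pt i).im} ∧
            ∀ i, |(((δ (φ (ψ₀ j)) : ℝ) : ℂ) * hexCenter u).re - (E.pt i).re| < ρc + 10 * δ (φ (ψ₀ j)) →
              |(((δ (φ (ψ₀ j)) : ℝ) : ℂ) * hexCenter u).im - (E.pt i).im| < ρc' →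
                g i (δ (φ (ψ₀ j))) 1 ≤ u.1 1} := by
    filter_upwards [hreach] with j h w π hπ y hy
    obtain ⟨hyE, hdisc, hz0, hz1⟩ := h w π hπ y hy
    show _ ∧ _ ∧ _
    rw [smul_hexCenter_neg_translate]
    have hrow : ((-(x j) + y.1) : Site 2) 1 = -(x j 1) + y.1 1 := by simp
    refine ⟨hyE, hdisc, Fin.forall_fin_two.2 ⟨fun hre him => ?_, fun hre him => ?_⟩⟩
    · rw [hrow, hg0row]; linarith [hz0 hre him]
    · rw [hrow, hg1row]; linarith [hz1 hre him]
  obtain ⟨Λ'', hmem, hcells⟩ := squeeze_cells' (Ω := D.carrier) E M (U := fun j =>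
      S (φ (ψ₀ j)) (n (φ (ψ₀ j))) ∪ T (φ (ψ₀ j)) (n' (φ (ψ₀ j))))
    (q := fun j => q (φ (ψ₀ j))) (q' := fun j => q' (φ (ψ₀ j)))
    (p := fun j => ((x j + (g 0 (δ (φ (ψ₀ j))) - Pi.single 1 1), 1) : HexVertex))
    (p' := fun j => ((x j + (g 1 (δ (φ (ψ₀ j))) - Pi.single 1 1), 1) : HexVertex))
    hs0 hρF hρc hFc hFc' hq_eq (fun j => rfl) hq'_eq (fun j => rfl) hglim_seq ha hb hinM
    hdepth hclosed hfaces hU hMD hMU hreach' hqdom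
  -- the index where everything holds
  obtain ⟨J, hJ⟩ := eventually_atTop.1 (hcells.and hprob)
  refine ⟨fun j => ψ₀ (J + j), M, τ, ρ', Λ', fun i δ' => g i δ' 1, a, b, fun j => x (J + j),
    fun j => Λ'' (J + j), fun j => ((x (J + j) + (g 0 (δ (φ (ψ₀ (J + j)))) - Pi.single 1 1), 1) : HexVertex),
    fun j => ((x (J + j) + (g 1 (δ (φ (ψ₀ (J + j)))) - Pi.single 1 1), 1) : HexVertex),
    strictMono_shift hψ₀ J, hbd, hbd0, hbd1, ⟨hρ', hflatM'⟩, ?_, hexhM, hlimM0, hlimM1, ?_, ?_,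
    E, ρ', φE, Φ, d, N, fun δ' => g 0 δ' 1, fun δ' => g 1 δ' 1, fun δ' => g 1 δ' 1, ⟨hρ', hflatE'⟩,
    hM, hφE, hΦ, hd, hlev, ?_, hexhE, hexhM, hlimE0, hlimE1, ?_⟩
  · exact hfamM
  · exact hτ.comp (tendsto_atTop_atTop.2 fun b => ⟨b, fun a ha => by omega⟩)
  · intro j
    obtain ⟨⟨h1, h2, h3, h4, h5, h6, h7, h8, h9, -, -, -⟩, -⟩ := hJ (J + j) (by omega)
    exact ⟨hmem (J + j), h1, h2, h3, h4, h5, h6, h7, h8, h9⟩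
  · exact hadm
  · refine Eventually.of_forall fun j => ?_
    obtain ⟨⟨h1, h2, h3, h4, h5, h6, h7, h8, h9, h10, h11, h12⟩, hP⟩ := hJ (J + j) (by omega)
    exact ⟨hP, hmem (J + j), h1, h2, h3, h4, h5, h6, h7, h8, h9, h10, h11, h12⟩

end Summit.CriticalPhenomena.SAWScalingLimit.Theorems.ObservableToSLE.TypeLadder

end
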